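import Literature.NumberTheory.Automorphic.ArchLocalTorusOrbitalBlockSmooth    -- ★ (A1) F0P3a: the generic Hörmander lemma `contDiffAt_integral_comp_of_contDiff_of_support`
import Literature.NumberTheory.Automorphic.ArchTorusOrbitalDeriv               -- ★ (V2)-smooth: `coe_conj_arch`, `coe_archDiagTorus_eq_diagonal`; brings ★ global properness `isCompact_setOf_exists_conj_archDiagTorus_mem`, ★ `isOpen_setOf_forall_injective`
import Literature.NumberTheory.Rogawski1990.ArchSmoothAmbientLift              -- ★ `ArchSmooth.exists_contDiff` (the letters' `C_c^∞(G′_∞)` = restriction of an ambient smooth `Θ`)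
import HarnessLib

/-!
# The GLOBAL torus orbital function `θ ↦ ∫_{G′_∞} Θ(↑↑(g·t(ζe^{iθ})·g⁻¹)) dν′(g)` of `G′_∞ = U(diag α)(L⁺ ⊗ ℝ)` is `C^∞` IN ALL THE ANGLES on the regular set
# (any signatures at the places; Rogawski 1990 §8.2–8.3, §14.5; Shelstad 1979 §4; Hörmander Thm. 1.1.9)

Topic `NumberTheory/Rogawski1990`; namespace `Literature.NumberTheory.Automorphic.UnitaryGroup` (§1–§3, the torus stack's) and `Literature.NumberTheory.Rogawski1990` (§4).  THEOREMS ONLY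
(no `def`, no instance, no notation, no axiom, no named fact, no `sorry`).  Cell `pub/hodgecm-mathlib`, line LH3 (closer stub `stub_N9`, crux H413 = `stmt-HodgeConjecture-24833`),
organ **(W1-smooth-def), Φ-half** of LH3-plan (g2)'s DEALER WORDS #2 (a4) — the `ContDiffOn ℝ ⊤` upgrade, in angle coordinates `θ : W → Fin N → ℝ`, of the compact-Cartan orbital factor of
★ (W1-cont) `ArchEndoscopicDeltaSideContinuous` (first clause (I₁) of organ (M1) «`Transf_Δ″` lands in `I^st_c(H_∞)`» of `MEMO-N9-direct-road.v1` §1∕§3, HOME `F0/P3c/LH3/LH3-plan/g2/`);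
author LH3-p04 (g2), 2026-09-02.  The GLOBAL all-angles twin of the per-place ★ (A1) `contDiffOn_integral_comp_conj_circleDiagonal_angles_of_blocks` (injective labelling) and the
all-orders upgrade of the global `C¹` ★ `contDiffOn_one_integral_comp_conj_archDiagTorus_curve` (one-angle curves).

THE MATHEMATICS [Rogawski1990 §8.3 p. 122; Shelstad1979 §4; Varadarajan1989 §2.4 Thm. 8].  `G′_∞ = U(diag α)(L⁺ ⊗ ℝ) ≃ Π_w U(σ_w diag α)(ℂ)` (ANY signatures, `α_i ≠ 0`), `t(z) =
archDiagTorus L N α z` its compact diagonal torus, `Θ : M_N(L ⊗ ℝ) → E` smooth with `g ↦ Θ(↑↑g)` compactly supported on `G′_∞` (the AMBIENT currency every letter's `C_c^∞` test function has,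
★ `ArchSmooth.exists_contDiff`), `ν′` finite on compacts.  Near a REGULAR angle `θ₀` (every `ζ_w e^{iθ₀,w}` injective) the torus points of a small closed ball stay regular (★
`isOpen_setOf_forall_injective`) and form a compact set, so ★ GLOBAL JOINT PROPERNESS `isCompact_setOf_exists_conj_archDiagTorus_mem` gives ONE compact `S ⊆ G′_∞` off which
`Θ(↑↑(g·t(ζe^{iθ})·g⁻¹)) = 0` for all `θ` in the ball; the integrand `Ψ((A, B), θ) = Θ(A · ↑↑t(ζe^{iθ}) · B)` is jointly smooth (`θ ↦ ↑↑t(ζe^{iθ})` is smooth: entrywise `ζ e^{iθ}` through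
the linear map `diag`, ★ `coe_archDiagTorus_eq_diagonal`) and `g ↦ (↑↑g, ↑↑g⁻¹)` is continuous — exactly the hypotheses of the Hörmander lemma ★ `contDiffAt_integral_comp_of_contDiff_of_support`.

WHAT IS PROVED.
* §1 `contDiff_coe_archDiagTorus_angles` — `θ ↦ ↑↑t(ζe^{iθ}) ∈ M_N(L ⊗ ℝ)` is `ContDiff ℝ ∞`.
* §2 `exists_closedBall_isCompact_apply_conj_archDiagTorus_angles_eq_zero` — uniform compact support on a closed ball of regular angles.
* §3 **`contDiffOn_integral_comp_conj_archDiagTorus_angles`** — `ContDiffOn ℝ ∞ (θ ↦ ∫ Θ(↑↑(g·t(ζe^{iθ})·g⁻¹)) dν′) {θ ∣ ∀ w, Injective (i ↦ ζ_{w,i} e^{iθ_{w,i}})}`;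
  `contDiff_integral_comp_conj_archDiagTorus_angles_of_compactSpace` — for COMPACT `G′_∞` (totally definite frame) `ContDiff ℝ ∞` on ALL of angle space.
* §4 **`ArchSmooth.contDiffOn_integral_comp_conj_archDiagTorus_angles`** — the same for a letter-currency test function `a′ ∈ C_c^∞(G′_∞)` (★ `ArchSmooth L N (diagonal α) a′`).
HONEST LABEL: HC_CM is proved only modulo the 7 printed citations (2 remaining: hLiu418 = stmt-HodgeConjecture-24832, h413 = stmt-HodgeConjecture-24833) until rung 0 closes; this is
(I₁)-level kit for organ (M1) of the LH3 direct road and pays nothing by itself.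

## References
* [Rogawski1990] J. D. Rogawski, *Automorphic Representations of Unitary Groups in Three Variables*, Ann. of Math. Stud. 123 (1990), §8.2 pp. 122–123, §8.3 p. 122, §8.4 p. 126, §14.5 p. 238.
* [Shelstad1979] D. Shelstad, *Characters and inner forms of a quasi-split group over `ℝ`*, Compositio Math. 39 (1979), §4.
* [Varadarajan1989] V. S. Varadarajan, *An Introduction to Harmonic Analysis on Semisimple Lie Groups* (1989), §2.4 Thm. 8.
* [HormanderALPDO1] L. Hörmander, *The Analysis of Linear Partial Differential Operators I* (1990), Thm. 1.1.9.
-/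

set_option autoImplicit false

noncomputable section

open MeasureTheory Measure NumberField NumberField.InfinitePlace NumberField.mixedEmbedding Filter Topology Set Function
open scoped Matrix MatrixGroups ContDiff Classical
open scoped Matrix.Norms.Operator

namespace Literature.NumberTheory.Automorphic.UnitaryGroup

open Literature.Analysis.Calculus

section Angles

variable (L : Type) [Field L] [NumberField L] [IsCMField L] (N : ℕ) (α : Fin N → L)
  {E : Type*} [NormedAddCommGroup E] [NormedSpace ℝ E] [CompleteSpace E]

/-! ## §1 The torus in angle coordinates is smooth in the ambient matrix algebra -/

/-- **`θ ↦ ↑↑t(ζe^{iθ}) ∈ M_N(L ⊗ ℝ)` IS `C^∞`** (★ `coe_archDiagTorus_eq_diagonal`: the matrix is `diag(d(θ))` with `d_i(θ) = (0, (ζ_{w,i} e^{iθ_{w,i}})_w)`; `diag` is ℝ-linear, each entry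
is `ζ · exp(iθ)`). [cite: Rogawski1990, §8.4 p. 126] [cite: BorelJacquet1979, §4.1] -/
theorem contDiff_coe_archDiagTorus_angles (ζ : {w : InfinitePlace L // IsComplex w} → Fin N → Circle) :
    ContDiff ℝ ∞ fun θ : {w : InfinitePlace L // IsComplex w} → Fin N → ℝ =>
      (((archDiagTorus L N α fun w i => ζ w i * Circle.exp (θ w i) : arch (↥(maximalRealSubfield L)) L (IsCMField.complexConj L) N (Matrix.diagonal α)) :
        GL (Fin N) (mixedSpace L)) : Matrix (Fin N) (Fin N) (mixedSpace L)) := by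
  let D : (Fin N → mixedSpace L) →L[ℝ] Matrix (Fin N) (Fin N) (mixedSpace L) :=
    LinearMap.toContinuousLinearMap (Matrix.diagonalLinearMap (Fin N) ℝ (mixedSpace L))
  have hD : ∀ d : Fin N → mixedSpace L, D d = Matrix.diagonal d := fun _ => rfl
  have hfun : (fun θ : {w : InfinitePlace L // IsComplex w} → Fin N → ℝ =>
      (((archDiagTorus L N α fun w i => ζ w i * Circle.exp (θ w i) : arch (↥(maximalRealSubfield L)) L (IsCMField.complexConj L) N (Matrix.diagonal α)) :
        GL (Fin N) (mixedSpace L)) : Matrix (Fin N) (Fin N) (mixedSpace L))) =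
      fun θ => D fun i : Fin N => ((0 : {w : InfinitePlace L // IsReal w} → ℝ),
        fun w : {w : InfinitePlace L // IsComplex w} => ((ζ w i * Circle.exp (θ w i) : Circle) : ℂ)) := by
    funext θ
    rw [coe_archDiagTorus_eq_diagonal, hD]
  rw [hfun]
  refine D.contDiff.comp (contDiff_pi.2 fun i => contDiff_const.prodMk (contDiff_pi.2 fun w => ?_))
  have h : (fun θ : {w : InfinitePlace L // IsComplex w} → Fin N → ℝ => ((ζ w i * Circle.exp (θ w i) : Circle) : ℂ)) =
      fun θ => (ζ w i : ℂ) * Complex.exp ((θ w i : ℂ) * Complex.I) := by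
    funext θ; rw [Circle.coe_mul, Circle.coe_exp]
  rw [h]
  exact contDiff_const.mul (Complex.contDiff_exp.comp
    ((Complex.ofRealCLM.contDiff.comp ((contDiff_apply ℝ ℝ i).comp (contDiff_apply ℝ (Fin N → ℝ) w))).mul contDiff_const))

/-! ## §2 Uniform compact support on a closed ball of regular angles -/

omit [NormedSpace ℝ E] [CompleteSpace E] in
/-- **UNIFORM COMPACT SUPPORT NEAR A REGULAR ANGLE**: if every `ζ_w e^{iθ₀,w}` is injective there are `δ > 0` and a compact `S ⊆ G′_∞` with `Θ(↑↑(g·t(ζe^{iθ})·g⁻¹)) = 0` for all `g ∉ S` and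
all `θ` in the closed `δ`-ball about `θ₀` (the ball's torus points form a compact subset of the OPEN regular set ★ `isOpen_setOf_forall_injective`; ★ GLOBAL JOINT PROPERNESS
`isCompact_setOf_exists_conj_archDiagTorus_mem`). [cite: Rogawski1990, §8.3 p. 122] [cite: DeitmarEchterhoff2014, Lemma 9.3.3] -/
theorem exists_closedBall_isCompact_apply_conj_archDiagTorus_angles_eq_zero (hα : ∀ i, α i ≠ 0) (Θ : Matrix (Fin N) (Fin N) (mixedSpace L) → E)
    (hfc : HasCompactSupport fun k : arch (↥(maximalRealSubfield L)) L (IsCMField.complexConj L) N (Matrix.diagonal α) =>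
      Θ (((k : GL (Fin N) (mixedSpace L)) : Matrix (Fin N) (Fin N) (mixedSpace L))))
    (ζ : {w : InfinitePlace L // IsComplex w} → Fin N → Circle) (θ₀ : {w : InfinitePlace L // IsComplex w} → Fin N → ℝ)
    (hθ₀ : ∀ w, Injective fun i => ζ w i * Circle.exp (θ₀ w i)) :
    ∃ δ : ℝ, 0 < δ ∧ ∃ S : Set (arch (↥(maximalRealSubfield L)) L (IsCMField.complexConj L) N (Matrix.diagonal α)), IsCompact S ∧
      ∀ g ∉ S, ∀ θ ∈ Metric.closedBall θ₀ δ,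
        Θ ((((g * archDiagTorus L N α (fun w i => ζ w i * Circle.exp (θ w i)) * g⁻¹ :
          arch (↥(maximalRealSubfield L)) L (IsCMField.complexConj L) N (Matrix.diagonal α)) : GL (Fin N) (mixedSpace L)) : Matrix (Fin N) (Fin N) (mixedSpace L))) = 0 := by
  have hzc : Continuous fun θ : {w : InfinitePlace L // IsComplex w} → Fin N → ℝ => fun w i => ζ w i * Circle.exp (θ w i) :=
    continuous_pi fun w => continuous_pi fun i => continuous_const.mul (Circle.exp.continuous.comp ((continuous_apply i).comp (continuous_apply w)))
  have hopen : IsOpen {z : {w : InfinitePlace L // IsComplex w} → Fin N → Circle | ∀ w, Injective (z w)} := Literature.Topology.isOpen_setOf_forall_injective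
  obtain ⟨δ, hδ, hball⟩ : ∃ δ > 0, Metric.closedBall θ₀ δ ⊆
      (fun θ : {w : InfinitePlace L // IsComplex w} → Fin N → ℝ => fun w i => ζ w i * Circle.exp (θ w i)) ⁻¹' {z | ∀ w, Injective (z w)} := by
    obtain ⟨ε, hε, hεball⟩ := Metric.mem_nhds_iff.1 ((hopen.preimage hzc).mem_nhds (show θ₀ ∈ _ from hθ₀))
    exact ⟨ε / 2, half_pos hε, (Metric.closedBall_subset_ball (half_lt_self hε)).trans hεball⟩
  have hKc : IsCompact ((fun θ : {w : InfinitePlace L // IsComplex w} → Fin N → ℝ => fun w i => ζ w i * Circle.exp (θ w i)) '' Metric.closedBall θ₀ δ) :=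
    (isCompact_closedBall θ₀ δ).image hzc
  have hKreg : (fun θ : {w : InfinitePlace L // IsComplex w} → Fin N → ℝ => fun w i => ζ w i * Circle.exp (θ w i)) '' Metric.closedBall θ₀ δ ⊆ {z | ∀ w, Injective (z w)} := by
    rintro _ ⟨θ, hθ, rfl⟩; exact hball hθ
  have hS := isCompact_setOf_exists_conj_archDiagTorus_mem L N α hα hKc hKreg hfc.isCompact
  refine ⟨δ, hδ, _, hS, fun g hg θ hθ => ?_⟩
  exact image_eq_zero_of_notMem_tsupport (f := fun k : arch (↥(maximalRealSubfield L)) L (IsCMField.complexConj L) N (Matrix.diagonal α) =>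
    Θ (((k : GL (Fin N) (mixedSpace L)) : Matrix (Fin N) (Fin N) (mixedSpace L)))) (fun h => hg ⟨_, ⟨θ, hθ, rfl⟩, h⟩)

/-! ## §3 Smoothness in all the angles on the regular set -/

variable [MeasurableSpace (arch (↥(maximalRealSubfield L)) L (IsCMField.complexConj L) N (Matrix.diagonal α))]
  [BorelSpace (arch (↥(maximalRealSubfield L)) L (IsCMField.complexConj L) N (Matrix.diagonal α))]

/-- **THE GLOBAL TORUS ORBITAL FUNCTION IS `C^∞` IN ALL THE ANGLES ON THE REGULAR SET** — `G′_∞ = U(diag α)(L⁺ ⊗ ℝ)` of ANY signatures (`α_i ≠ 0`), `ν′` finite on compacts, `Θ` smooth on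
`M_N(L ⊗ ℝ)` with `g ↦ Θ(↑↑g)` compactly supported on `G′_∞`: `θ ↦ ∫_{G′_∞} Θ(↑↑(g·t(ζe^{iθ})·g⁻¹)) dν′(g)` is `ContDiffOn ℝ ∞` on `{θ ∣ ∀ w, (i ↦ ζ_{w,i} e^{iθ_{w,i}}) injective}`
(Hörmander ★ `contDiffAt_integral_comp_of_contDiff_of_support` at each point, with §2's uniform compact support; `Ψ((A, B), θ) = Θ(A · ↑↑t(ζe^{iθ}) · B)`, `y(g) = (↑↑g, ↑↑g⁻¹)`).
[cite: Rogawski1990, §8.3 p. 122; §8.4 p. 126] [cite: Shelstad1979, §4] [cite: Varadarajan1989, §2.4 Thm. 8] [cite: HormanderALPDO1, Thm. 1.1.9] -/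
theorem contDiffOn_integral_comp_conj_archDiagTorus_angles (hα : ∀ i, α i ≠ 0)
    (ν : Measure (arch (↥(maximalRealSubfield L)) L (IsCMField.complexConj L) N (Matrix.diagonal α))) [IsFiniteMeasureOnCompacts ν]
    (Θ : Matrix (Fin N) (Fin N) (mixedSpace L) → E) (hΘ : ContDiff ℝ ∞ Θ)
    (hfc : HasCompactSupport fun k : arch (↥(maximalRealSubfield L)) L (IsCMField.complexConj L) N (Matrix.diagonal α) =>
      Θ (((k : GL (Fin N) (mixedSpace L)) : Matrix (Fin N) (Fin N) (mixedSpace L))))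
    (ζ : {w : InfinitePlace L // IsComplex w} → Fin N → Circle) :
    ContDiffOn ℝ ∞ (fun θ : {w : InfinitePlace L // IsComplex w} → Fin N → ℝ => ∫ g : arch (↥(maximalRealSubfield L)) L (IsCMField.complexConj L) N (Matrix.diagonal α),
        Θ ((((g * archDiagTorus L N α (fun w i => ζ w i * Circle.exp (θ w i)) * g⁻¹ :
          arch (↥(maximalRealSubfield L)) L (IsCMField.complexConj L) N (Matrix.diagonal α)) : GL (Fin N) (mixedSpace L)) : Matrix (Fin N) (Fin N) (mixedSpace L))) ∂ν)
      {θ | ∀ w, Injective fun i => ζ w i * Circle.exp (θ w i)} := by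
  intro θ₀ hθ₀
  refine ContDiffAt.contDiffWithinAt ?_
  -- the jointly smooth integrand and the continuous parameter map
  set Ψ : (Matrix (Fin N) (Fin N) (mixedSpace L) × Matrix (Fin N) (Fin N) (mixedSpace L)) × ({w : InfinitePlace L // IsComplex w} → Fin N → ℝ) → E :=
    fun q => Θ (q.1.1 * (((archDiagTorus L N α fun w i => ζ w i * Circle.exp (q.2 w i) : arch (↥(maximalRealSubfield L)) L (IsCMField.complexConj L) N (Matrix.diagonal α)) :
      GL (Fin N) (mixedSpace L)) : Matrix (Fin N) (Fin N) (mixedSpace L)) * q.1.2) with hΨ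
  have hΨd : ContDiff ℝ ∞ Ψ :=
    hΘ.comp (((contDiff_fst.comp contDiff_fst).mul ((contDiff_coe_archDiagTorus_angles L N α ζ).comp contDiff_snd)).mul (contDiff_snd.comp contDiff_fst))
  set y : arch (↥(maximalRealSubfield L)) L (IsCMField.complexConj L) N (Matrix.diagonal α) → Matrix (Fin N) (Fin N) (mixedSpace L) × Matrix (Fin N) (Fin N) (mixedSpace L) :=
    fun g => (((g : GL (Fin N) (mixedSpace L)) : Matrix (Fin N) (Fin N) (mixedSpace L)),
      (((g⁻¹ : arch (↥(maximalRealSubfield L)) L (IsCMField.complexConj L) N (Matrix.diagonal α)) : GL (Fin N) (mixedSpace L)) : Matrix (Fin N) (Fin N) (mixedSpace L))) with hy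
  have hyc : Continuous y :=
    (Units.continuous_val.comp continuous_subtype_val).prodMk ((Units.continuous_val.comp continuous_subtype_val).comp continuous_inv)
  have hΨy : ∀ (g : arch (↥(maximalRealSubfield L)) L (IsCMField.complexConj L) N (Matrix.diagonal α)) (θ : {w : InfinitePlace L // IsComplex w} → Fin N → ℝ), Ψ (y g, θ) =
      Θ ((((g * archDiagTorus L N α (fun w i => ζ w i * Circle.exp (θ w i)) * g⁻¹ :
        arch (↥(maximalRealSubfield L)) L (IsCMField.complexConj L) N (Matrix.diagonal α)) : GL (Fin N) (mixedSpace L)) : Matrix (Fin N) (Fin N) (mixedSpace L))) := fun g θ => by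
    simp only [hΨ, hy, coe_conj_arch]
  -- the uniform compact support near `θ₀`
  obtain ⟨δ, hδ, S, hS, hS0⟩ := exists_closedBall_isCompact_apply_conj_archDiagTorus_angles_eq_zero L N α hα Θ hfc ζ θ₀ hθ₀
  have key := contDiffAt_integral_comp_of_contDiff_of_support ν Ψ hΨd y hyc θ₀ hS (Metric.closedBall_mem_nhds θ₀ hδ)
    (fun g hg θ hθ => by rw [hΨy]; exact hS0 g hg θ hθ)
  have hfun : (fun θ : {w : InfinitePlace L // IsComplex w} → Fin N → ℝ => ∫ g : arch (↥(maximalRealSubfield L)) L (IsCMField.complexConj L) N (Matrix.diagonal α),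
      Θ ((((g * archDiagTorus L N α (fun w i => ζ w i * Circle.exp (θ w i)) * g⁻¹ :
        arch (↥(maximalRealSubfield L)) L (IsCMField.complexConj L) N (Matrix.diagonal α)) : GL (Fin N) (mixedSpace L)) : Matrix (Fin N) (Fin N) (mixedSpace L))) ∂ν) =
      fun X => ∫ t, Ψ (y t, X) ∂ν := by
    funext θ
    exact integral_congr_ae (Eventually.of_forall fun g => (hΨy g θ).symm)
  rw [hfun]
  exact key

/-- **COMPACT `G′_∞` (totally definite frame): the torus orbital function is `C^∞` in all the angles EVERYWHERE — no regularity, no support hypothesis** (the uniform compact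
support is the whole compact group; Hörmander ★ `contDiffAt_integral_comp_of_contDiff_of_support` with `S = univ`).  The global twin of the per-place ★
`contDiff_integral_comp_conj_circleDiagonal_angles_of_posDef`; input (SM-G′-cpt-all) of LH3-plan (g2)'s organ (D-i-def). [cite: Rogawski1990, §8.4 p. 126; §14.5 p. 238] [cite: HormanderALPDO1, Thm. 1.1.9] -/
theorem contDiff_integral_comp_conj_archDiagTorus_angles_of_compactSpace [CompactSpace (arch (↥(maximalRealSubfield L)) L (IsCMField.complexConj L) N (Matrix.diagonal α))]
    (ν : Measure (arch (↥(maximalRealSubfield L)) L (IsCMField.complexConj L) N (Matrix.diagonal α))) [IsFiniteMeasureOnCompacts ν]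
    (Θ : Matrix (Fin N) (Fin N) (mixedSpace L) → E) (hΘ : ContDiff ℝ ∞ Θ) (ζ : {w : InfinitePlace L // IsComplex w} → Fin N → Circle) :
    ContDiff ℝ ∞ (fun θ : {w : InfinitePlace L // IsComplex w} → Fin N → ℝ => ∫ g : arch (↥(maximalRealSubfield L)) L (IsCMField.complexConj L) N (Matrix.diagonal α),
        Θ ((((g * archDiagTorus L N α (fun w i => ζ w i * Circle.exp (θ w i)) * g⁻¹ :
          arch (↥(maximalRealSubfield L)) L (IsCMField.complexConj L) N (Matrix.diagonal α)) : GL (Fin N) (mixedSpace L)) : Matrix (Fin N) (Fin N) (mixedSpace L))) ∂ν) := by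
  set Ψ : (Matrix (Fin N) (Fin N) (mixedSpace L) × Matrix (Fin N) (Fin N) (mixedSpace L)) × ({w : InfinitePlace L // IsComplex w} → Fin N → ℝ) → E :=
    fun q => Θ (q.1.1 * (((archDiagTorus L N α fun w i => ζ w i * Circle.exp (q.2 w i) : arch (↥(maximalRealSubfield L)) L (IsCMField.complexConj L) N (Matrix.diagonal α)) :
      GL (Fin N) (mixedSpace L)) : Matrix (Fin N) (Fin N) (mixedSpace L)) * q.1.2) with hΨ
  have hΨd : ContDiff ℝ ∞ Ψ :=
    hΘ.comp (((contDiff_fst.comp contDiff_fst).mul ((contDiff_coe_archDiagTorus_angles L N α ζ).comp contDiff_snd)).mul (contDiff_snd.comp contDiff_fst))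
  set y : arch (↥(maximalRealSubfield L)) L (IsCMField.complexConj L) N (Matrix.diagonal α) → Matrix (Fin N) (Fin N) (mixedSpace L) × Matrix (Fin N) (Fin N) (mixedSpace L) :=
    fun g => (((g : GL (Fin N) (mixedSpace L)) : Matrix (Fin N) (Fin N) (mixedSpace L)),
      (((g⁻¹ : arch (↥(maximalRealSubfield L)) L (IsCMField.complexConj L) N (Matrix.diagonal α)) : GL (Fin N) (mixedSpace L)) : Matrix (Fin N) (Fin N) (mixedSpace L))) with hy
  have hyc : Continuous y :=
    (Units.continuous_val.comp continuous_subtype_val).prodMk ((Units.continuous_val.comp continuous_subtype_val).comp continuous_inv)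
  have hΨy : ∀ (g : arch (↥(maximalRealSubfield L)) L (IsCMField.complexConj L) N (Matrix.diagonal α)) (θ : {w : InfinitePlace L // IsComplex w} → Fin N → ℝ), Ψ (y g, θ) =
      Θ ((((g * archDiagTorus L N α (fun w i => ζ w i * Circle.exp (θ w i)) * g⁻¹ :
        arch (↥(maximalRealSubfield L)) L (IsCMField.complexConj L) N (Matrix.diagonal α)) : GL (Fin N) (mixedSpace L)) : Matrix (Fin N) (Fin N) (mixedSpace L))) := fun g θ => by
    simp only [hΨ, hy, coe_conj_arch]
  have hfun : (fun θ : {w : InfinitePlace L // IsComplex w} → Fin N → ℝ => ∫ g : arch (↥(maximalRealSubfield L)) L (IsCMField.complexConj L) N (Matrix.diagonal α),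
      Θ ((((g * archDiagTorus L N α (fun w i => ζ w i * Circle.exp (θ w i)) * g⁻¹ :
        arch (↥(maximalRealSubfield L)) L (IsCMField.complexConj L) N (Matrix.diagonal α)) : GL (Fin N) (mixedSpace L)) : Matrix (Fin N) (Fin N) (mixedSpace L))) ∂ν) =
      fun X => ∫ t, Ψ (y t, X) ∂ν := by
    funext θ
    exact integral_congr_ae (Eventually.of_forall fun g => (hΨy g θ).symm)
  rw [hfun]
  exact contDiff_iff_contDiffAt.2 fun θ₀ =>
    contDiffAt_integral_comp_of_contDiff_of_support ν Ψ hΨd y hyc θ₀ isCompact_univ univ_mem (fun g hg _ _ => absurd (mem_univ g) hg)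

end Angles

end Literature.NumberTheory.Automorphic.UnitaryGroup

/-! ## §4 Letter-currency test functions `a′ ∈ C_c^∞(G′_∞)` -/

namespace Literature.NumberTheory.Rogawski1990

open Literature.NumberTheory.Automorphic Literature.NumberTheory.Automorphic.UnitaryGroup

section Smooth

variable (L : Type) [Field L] [NumberField L] [IsCMField L] (N : ℕ) (α : Fin N → L)
  [MeasurableSpace ↥(UnitaryGroup.arch (↥(maximalRealSubfield L)) L (IsCMField.complexConj L) N (Matrix.diagonal α))]
  [BorelSpace ↥(UnitaryGroup.arch (↥(maximalRealSubfield L)) L (IsCMField.complexConj L) N (Matrix.diagonal α))]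

/-- **THE TORUS ORBITAL FUNCTION OF A TEST FUNCTION `a′ ∈ C_c^∞(G′_∞)` IS `C^∞` IN ALL THE ANGLES ON THE REGULAR SET** (★ `ArchSmooth.exists_contDiff`: `a′ = Θ ∘ ↑↑` for an ambient smooth
compactly supported `Θ`; then §3). [cite: Rogawski1990, §14.2 p. 233; §8.3 p. 122] [cite: Shelstad1979, §4] [cite: BorelJacquet1979, §4.1] -/
theorem ArchSmooth.contDiffOn_integral_comp_conj_archDiagTorus_angles (hα : ∀ i, α i ≠ 0)
    (ν : Measure ↥(UnitaryGroup.arch (↥(maximalRealSubfield L)) L (IsCMField.complexConj L) N (Matrix.diagonal α))) [IsFiniteMeasureOnCompacts ν]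
    {a : ↥(UnitaryGroup.arch (↥(maximalRealSubfield L)) L (IsCMField.complexConj L) N (Matrix.diagonal α)) → ℂ} (ha : ArchSmooth L N (Matrix.diagonal α) a)
    (ζ : {w : InfinitePlace L // IsComplex w} → Fin N → Circle) :
    ContDiffOn ℝ ∞ (fun θ : {w : InfinitePlace L // IsComplex w} → Fin N → ℝ => ∫ g : ↥(UnitaryGroup.arch (↥(maximalRealSubfield L)) L (IsCMField.complexConj L) N (Matrix.diagonal α)),
        a (g * UnitaryGroup.archDiagTorus L N α (fun w i => ζ w i * Circle.exp (θ w i)) * g⁻¹) ∂ν)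
      {θ | ∀ w, Function.Injective fun i => ζ w i * Circle.exp (θ w i)} := by
  obtain ⟨Θ, hΘ, -, hΘc, haΘ⟩ := ha.exists_contDiff
  have hfun : (fun θ : {w : InfinitePlace L // IsComplex w} → Fin N → ℝ => ∫ g : ↥(UnitaryGroup.arch (↥(maximalRealSubfield L)) L (IsCMField.complexConj L) N (Matrix.diagonal α)),
      a (g * UnitaryGroup.archDiagTorus L N α (fun w i => ζ w i * Circle.exp (θ w i)) * g⁻¹) ∂ν) =
      fun θ => ∫ g : ↥(UnitaryGroup.arch (↥(maximalRealSubfield L)) L (IsCMField.complexConj L) N (Matrix.diagonal α)),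
        Θ ((((g * UnitaryGroup.archDiagTorus L N α (fun w i => ζ w i * Circle.exp (θ w i)) * g⁻¹ :
          ↥(UnitaryGroup.arch (↥(maximalRealSubfield L)) L (IsCMField.complexConj L) N (Matrix.diagonal α))) : GL (Fin N) (mixedEmbedding.mixedSpace L)) :
            Matrix (Fin N) (Fin N) (mixedEmbedding.mixedSpace L))) ∂ν := by
    funext θ
    exact integral_congr_ae (Eventually.of_forall fun g => haΘ _)
  rw [hfun]
  exact UnitaryGroup.contDiffOn_integral_comp_conj_archDiagTorus_angles L N α hα ν Θ hΘ hΘc ζ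

end Smooth

end Literature.NumberTheory.Rogawski1990

end
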